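import Mathlib

/-!
# `GrenetZeon.DualUnipotentThreeHalves` (stmt-ValiantsHypothesis-24318), stub (c) `SlowCore.LongMassSlowLawInv` —
# the BIPARTITE SQUARE-ROOT CRITERION and the GRAFT species (fat ∧ long ∧ irreducible nilpotent spaces exist)

leafhand-val-grenetzeon-2 gen28 (29th hand), 2026-09-01.  Def-free matrix algebra over a commutative ring / a field; every
statement is about explicit block matrices (`Matrix.fromBlocks`, `Matrix.fromCols`, `Matrix.fromRows`).

## §1 Bipartite square-root criterion
For `Q : Matrix l m R`, `P : Matrix m l R` the bipartite matrix `M = fromBlocks 0 Q P 0` satisfies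
`M ^ (2j) = fromBlocks ((QP)^j) 0 0 ((PQ)^j)` and `M ^ (2j+1) = fromBlocks 0 ((QP)^j Q) ((PQ)^j P) 0`
(`bipartite_pow_even`, `bipartite_pow_odd`); hence `(QP)^j = 0 ⇒ M^(2j+1) = 0` (`bipartite_pow_odd_eq_zero`) and
`(QP)^j ≠ 0 ⇒ M^(2j) ≠ 0` (`bipartite_pow_even_ne_zero`).  So a LINEAR space of bipartite matrices is a nilpotent space
as soon as the QUADRATIC pencil `Q(w)·P(w)` takes nilpotent values — the square-root mechanism behind every signed
cancellation in print (MOR 1991 §5: `[[0,T,0],[sI,0,T],[0,-sI,0]]`, `Q·P = sT − Ts = 0`).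

## §2 The GRAFT species
`graft(T, N, s) := [[0, T, 0], [s·1, 0, T + N], [0, −s·1, 0]]` on three layers `L₁, L₂, L₃ ≅ ι` (written below with the layer
order `L₂ ⊕ (L₁ ⊕ L₃)` as `fromBlocks 0 (fromCols (s • 1) (T + N)) (fromRows T (-(s • 1))) 0`), `T` ARBITRARY, `N` in any nilpotent
space `𝒩`, `s` a scalar.  Here `Q·P = s·T − (T + N)·s = −s·N` (`graft_QP`), so
* NILPOTENT: `N^j = 0 ⇒ graft^(2j+1) = 0` (`graft_pow_eq_zero`);
* LONG: `s ≠ 0, N^j ≠ 0 ⇒ graft^(2j) ≠ 0` (`graft_pow_ne_zero`) — index `2·index(N) + 1`;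
* FAT: the parametrisation is injective (`graft_inj`): with `𝒩 = 𝔫_k` (strictly upper triangular) the value space has dimension
  `k² + k(k−1)/2 + 1 ≈ b²/6` in `M_b`, `b = 3k`, and maximal index `2k − 1 ≈ 2b/3`;
* IRREDUCIBLE for EVERY `𝒩 ∋ 0` (`graft_irreducible`): no common invariant subspace (the algebra generated contains `M_k ⊗ M₃`).
So FAT ∧ LONG ∧ WILD(irreducible) nilpotent linear spaces EXIST (the 27th hand's census, `CENSUS-leafhand2-g26-…` §3, had the known
irreducible spaces fat XOR long: MOR `𝓜_{3k}` index 3, `span{S, R_{b−2}}` dim 2, inflations `U_{p,k}` dim·index ≈ b²).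

## §3 Why the graft is NOT a (c)-violator (paper, see `Cruxes/DualUnipotentThreeHalves/CENSUS-leafhand2-g28-bipartite-graft.md`)
Along a direction `u = (T_u, N_u, 0)` every power of `graft` is `± s₀^a · (P·N^a·Q | N^a | P N^a | N^a Q)` with `P, Q` of line-degree
`≤ 1`, so the `T`-directions are universally SLOW (degree ≤ 2) and the price is that of the sub-pencil `𝒩` plus `2n + 1`:
`price_n(graft 𝒩) ≤ price_n(𝒩) + 2n + 1`; for `𝒩 = 𝔫_k` the band certificate gives `RelCert` at constant `c = 2`.  The violator portrait
(`…NilSpaceViolatorPortraitTwo`) therefore gains a line: fat ∧ long ∧ wild is NOT sufficient — the FAST directions themselves must be fat.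

Honest framing.  Helper algebra (`--supports stmt-ValiantsHypothesis-24318`); nothing here proves (c), S3, 24318, 8062 or `VP ≠ VNP` —
all OPEN / NOT proved.  No definitions, no sorry, standard axioms. [folklore block-matrix algebra; MOR 1991 §5 for the 3 × 3 gadget]
-/

set_option linter.dupNamespace false
set_option autoImplicit false

namespace Summit.ValiantsHypothesis.ValiantsHypothesis.Theorems.GrenetZeon.BipartiteGraft

open Matrix

/-! ## §1 Bipartite square-root criterion -/

section Bipartite

variable {R : Type*} [CommRing R]
variable {l m : Type*} [Fintype l] [Fintype m] [DecidableEq l] [DecidableEq m]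

omit [DecidableEq l] [DecidableEq m] in
/-- The square of a bipartite matrix is block diagonal: `[[0,Q],[P,0]]² = [[QP,0],[0,PQ]]`. [folklore] -/
theorem bipartite_sq (Q : Matrix l m R) (P : Matrix m l R) :
    fromBlocks 0 Q P 0 * fromBlocks 0 Q P 0 = fromBlocks (Q * P) 0 0 (P * Q) := by
  simp only [fromBlocks_multiply, Matrix.zero_mul, Matrix.mul_zero, zero_add, add_zero]

/-- Even powers of a bipartite matrix: `[[0,Q],[P,0]]^(2j) = [[(QP)^j, 0],[0, (PQ)^j]]`. [folklore] -/
theorem bipartite_pow_even (Q : Matrix l m R) (P : Matrix m l R) (j : ℕ) :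
    (fromBlocks 0 Q P 0) ^ (2 * j) = fromBlocks ((Q * P) ^ j) 0 0 ((P * Q) ^ j) := by
  rw [pow_mul, pow_two, bipartite_sq, fromBlocks_diagonal_pow]

/-- Odd powers of a bipartite matrix: `[[0,Q],[P,0]]^(2j+1) = [[0, (QP)^j Q],[(PQ)^j P, 0]]`. [folklore] -/
theorem bipartite_pow_odd (Q : Matrix l m R) (P : Matrix m l R) (j : ℕ) :
    (fromBlocks 0 Q P 0) ^ (2 * j + 1) = fromBlocks 0 ((Q * P) ^ j * Q) ((P * Q) ^ j * P) 0 := by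
  rw [pow_succ, bipartite_pow_even]
  simp only [fromBlocks_multiply, Matrix.zero_mul, Matrix.mul_zero, zero_add, add_zero]

/-- `(PQ)^j · P = P · (QP)^j`. [folklore] -/
theorem pow_mul_shift (Q : Matrix l m R) (P : Matrix m l R) (j : ℕ) :
    (P * Q) ^ j * P = P * (Q * P) ^ j := by
  induction j with
  | zero => rw [pow_zero, pow_zero, Matrix.one_mul, Matrix.mul_one]
  | succ j ih =>
    calc (P * Q) ^ (j + 1) * P = (P * Q) ^ j * P * (Q * P) := by
            rw [pow_succ, Matrix.mul_assoc, Matrix.mul_assoc, Matrix.mul_assoc]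
      _ = P * (Q * P) ^ (j + 1) := by rw [ih, Matrix.mul_assoc, ← pow_succ]

/-- **Bipartite square-root criterion (nilpotency transfer).**  If the quadratic block `QP` satisfies `(QP)^j = 0` then the
bipartite matrix satisfies `[[0,Q],[P,0]]^(2j+1) = 0`. [folklore] -/
theorem bipartite_pow_odd_eq_zero (Q : Matrix l m R) (P : Matrix m l R) {j : ℕ} (h : (Q * P) ^ j = 0) :
    (fromBlocks 0 Q P 0) ^ (2 * j + 1) = 0 := by
  rw [bipartite_pow_odd, h, Matrix.zero_mul, pow_mul_shift Q P j, h, Matrix.mul_zero, fromBlocks_zero]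

/-- All powers from `2j+1` on vanish. [folklore] -/
theorem bipartite_pow_eq_zero_of_le (Q : Matrix l m R) (P : Matrix m l R) {j e : ℕ} (h : (Q * P) ^ j = 0)
    (he : 2 * j + 1 ≤ e) : (fromBlocks 0 Q P 0) ^ e = 0 := by
  obtain ⟨d, rfl⟩ := Nat.exists_eq_add_of_le he
  rw [pow_add, bipartite_pow_odd_eq_zero Q P h, zero_mul]

/-- **Length transfer.**  If `(QP)^j ≠ 0` then `[[0,Q],[P,0]]^(2j) ≠ 0` (its upper-left block is `(QP)^j`). [folklore] -/
theorem bipartite_pow_even_ne_zero (Q : Matrix l m R) (P : Matrix m l R) {j : ℕ} (h : (Q * P) ^ j ≠ 0) :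
    (fromBlocks 0 Q P 0) ^ (2 * j) ≠ 0 := by
  intro h0
  apply h
  have h1 : ((fromBlocks 0 Q P 0) ^ (2 * j)).toBlocks₁₁ = (Q * P) ^ j := by
    rw [bipartite_pow_even, toBlocks_fromBlocks₁₁]
  rw [← h1, h0]
  ext i j
  rfl

end Bipartite

/-! ## §2 The graft: `Q = [s·1 | T + N]`, `P = [T ; −s·1]`, `Q·P = −s·N` -/

section Graft

variable {R : Type*} [CommRing R] {ι : Type*} [Fintype ι] [DecidableEq ι]

/-- The quadratic block of the graft: `[s·1 | T+N] · [T ; −s·1] = −s·N` — the arbitrary matrix `T` CANCELS. [folklore] -/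
theorem graft_QP (T N : Matrix ι ι R) (s : R) :
    fromCols (s • (1 : Matrix ι ι R)) (T + N) * fromRows T (-(s • (1 : Matrix ι ι R))) = -(s • N) := by
  rw [fromCols_mul_fromRows, Matrix.mul_neg, Matrix.mul_smul, Matrix.mul_one, Matrix.smul_mul, Matrix.one_mul, smul_add]
  abel

/-- **The graft is nilpotent**: `N^j = 0 ⇒ graft(T,N,s)^(2j+1) = 0`, for EVERY `T`. [folklore] -/
theorem graft_pow_eq_zero (T N : Matrix ι ι R) (s : R) {j : ℕ} (hN : N ^ j = 0) :
    (fromBlocks 0 (fromCols (s • (1 : Matrix ι ι R)) (T + N)) (fromRows T (-(s • (1 : Matrix ι ι R)))) 0) ^ (2 * j + 1)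
      = 0 := by
  apply bipartite_pow_odd_eq_zero
  rw [graft_QP, ← neg_smul, smul_pow, hN, smul_zero]

/-- All powers of the graft from `2j+1` on vanish (in particular the `b`-th power, `b = 3·|ι| ≥ 2j+1`). [folklore] -/
theorem graft_pow_eq_zero_of_le (T N : Matrix ι ι R) (s : R) {j e : ℕ} (hN : N ^ j = 0) (he : 2 * j + 1 ≤ e) :
    (fromBlocks 0 (fromCols (s • (1 : Matrix ι ι R)) (T + N)) (fromRows T (-(s • (1 : Matrix ι ι R)))) 0) ^ e = 0 := by
  apply bipartite_pow_eq_zero_of_le _ _ _ he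
  rw [graft_QP, ← neg_smul, smul_pow, hN, smul_zero]

omit [Fintype ι] in
/-- **The graft is injectively parametrised** by `(T, N, s·1)` (fatness: the value space over `T ∈ M_k`, `N ∈ 𝒩`, `s` has
dimension `k² + dim 𝒩 + 1` when `k ≥ 1`). [folklore] -/
theorem graft_inj {T T' N N' : Matrix ι ι R} {s s' : R}
    (h : fromBlocks 0 (fromCols (s • (1 : Matrix ι ι R)) (T + N)) (fromRows T (-(s • (1 : Matrix ι ι R)))) 0
      = fromBlocks 0 (fromCols (s' • (1 : Matrix ι ι R)) (T' + N')) (fromRows T' (-(s' • (1 : Matrix ι ι R)))) 0) :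
    T = T' ∧ N = N' ∧ s • (1 : Matrix ι ι R) = s' • (1 : Matrix ι ι R) := by
  obtain ⟨-, hQ, hP, -⟩ := fromBlocks_inj.mp h
  obtain ⟨hs, hTN⟩ := fromCols_inj hQ
  obtain ⟨hT, -⟩ := fromRows_inj hP
  refine ⟨hT, ?_, hs⟩
  rw [hT] at hTN
  exact add_left_cancel hTN

end Graft

section Long

variable {R : Type*} [CommRing R] [IsDomain R] {ι : Type*} [Fintype ι] [DecidableEq ι]

/-- **The graft is long**: over a domain, `s ≠ 0` and `N^j ≠ 0` give `graft(T,N,s)^(2j) ≠ 0` (its `L₂`-block is `(−s)^j N^j`);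
with `N` the full shift of `M_k` the index is `2k − 1` while the size is `3k`. [folklore] -/
theorem graft_pow_ne_zero (T N : Matrix ι ι R) {s : R} (hs : s ≠ 0) {j : ℕ} (hN : N ^ j ≠ 0) :
    (fromBlocks 0 (fromCols (s • (1 : Matrix ι ι R)) (T + N)) (fromRows T (-(s • (1 : Matrix ι ι R)))) 0) ^ (2 * j)
      ≠ 0 := by
  apply bipartite_pow_even_ne_zero
  rw [graft_QP, ← neg_smul, smul_pow]
  exact smul_ne_zero (pow_ne_zero j (neg_ne_zero.mpr hs)) hN

end Long

/-! ## §3 The graft is irreducible (no common invariant subspace), for every coefficient space `𝒩 ∋ 0` -/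

section Irreducible

variable {𝕜 : Type*} [Field 𝕜] {ι : Type*} [Fintype ι] [DecidableEq ι]

/-- Action of the graft on a vector written layer-wise `(a ; b, c) ∈ L₂ ⊕ (L₁ ⊕ L₃)`:
`(a; b, c) ↦ (s·b + (T+N)c ; T a, −s·a)`. [folklore] -/
theorem graft_mulVec (T N : Matrix ι ι 𝕜) (s : 𝕜) (a b c : ι → 𝕜) :
    (fromBlocks 0 (fromCols (s • (1 : Matrix ι ι 𝕜)) (T + N)) (fromRows T (-(s • (1 : Matrix ι ι 𝕜)))) 0) *ᵥ
        Sum.elim a (Sum.elim b c)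
      = Sum.elim (s • b + (T + N) *ᵥ c) (Sum.elim (T *ᵥ a) (-(s • a))) := by
  simp only [fromBlocks_mulVec, Sum.elim_comp_inl, Sum.elim_comp_inr, Matrix.zero_mulVec, zero_add, add_zero,
    fromCols_mulVec_sumElim, fromRows_mulVec, Matrix.smul_mulVec, Matrix.one_mulVec, Matrix.neg_mulVec]

/-- **The graft space is irreducible.**  If a subspace `W` of `L₂ ⊕ (L₁ ⊕ L₃)` is invariant under `graft(T, N, s)` for all
`T ∈ M_k`, all `N` in a coefficient set `𝒩 ∋ 0` and all scalars `s`, then `W = ⊥` or `W = ⊤`.  (Only `graft(T,0,0)` and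
`graft(0,0,1)` are used: from any non-zero vector one reaches all of `L₁` by a rank-one `T`, then `L₂`, `L₃` by `graft(0,0,1)`.)
[folklore] -/
theorem graft_irreducible (𝒩 : Set (Matrix ι ι 𝕜)) (h0 : (0 : Matrix ι ι 𝕜) ∈ 𝒩) (W : Submodule 𝕜 (ι ⊕ (ι ⊕ ι) → 𝕜))
    (hW : ∀ (T N : Matrix ι ι 𝕜) (s : 𝕜), N ∈ 𝒩 → ∀ w ∈ W,
      (fromBlocks 0 (fromCols (s • (1 : Matrix ι ι 𝕜)) (T + N)) (fromRows T (-(s • (1 : Matrix ι ι 𝕜)))) 0) *ᵥ w ∈ W) :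
    W = ⊥ ∨ W = ⊤ := by
  classical
  by_cases hbot : W = ⊥
  · exact Or.inl hbot
  right
  -- the two moves
  have hE : ∀ (T : Matrix ι ι 𝕜) (a b c : ι → 𝕜), Sum.elim a (Sum.elim b c) ∈ W →
      Sum.elim (T *ᵥ c) (Sum.elim (T *ᵥ a) (0 : ι → 𝕜)) ∈ W := by
    intro T a b c h
    have h1 := hW T 0 0 h0 _ h
    rw [graft_mulVec] at h1
    simp only [zero_smul, zero_add, add_zero, neg_zero] at h1
    exact h1
  have hF : ∀ (a b c : ι → 𝕜), Sum.elim a (Sum.elim b c) ∈ W →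
      Sum.elim b (Sum.elim (0 : ι → 𝕜) (-a)) ∈ W := by
    intro a b c h
    have h1 := hW 0 0 1 h0 _ h
    rw [graft_mulVec] at h1
    simp only [one_smul, add_zero, Matrix.zero_mulVec] at h1
    exact h1
  -- from a vector with non-zero `L₂`-part and zero `L₃`-part, a rank-one `T` reaches every vector of `L₁`
  have hL1 : ∀ (a b : ι → 𝕜), a ≠ 0 → Sum.elim a (Sum.elim b (0 : ι → 𝕜)) ∈ W →
      ∀ x : ι → 𝕜, Sum.elim (0 : ι → 𝕜) (Sum.elim x (0 : ι → 𝕜)) ∈ W := by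
    intro a b ha h x
    obtain ⟨i, hi⟩ : ∃ i, a i ≠ 0 := by
      by_contra hcon
      push Not at hcon
      exact ha (funext hcon)
    let T : Matrix ι ι 𝕜 := Matrix.of fun p q => if q = i then x p * (a i)⁻¹ else 0
    have hTa : T *ᵥ a = x := by
      ext p
      simp only [T, Matrix.mulVec, dotProduct, Matrix.of_apply, ite_mul, zero_mul, Finset.sum_ite_eq',
        Finset.mem_univ, if_true]
      rw [mul_assoc, inv_mul_cancel₀ hi, mul_one]
    have h1 := hE T a b 0 h
    rw [Matrix.mulVec_zero, hTa] at h1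
    exact h1
  -- a non-zero vector of `W`, written layer-wise
  obtain ⟨w, hwW, hw0⟩ : ∃ w ∈ W, w ≠ 0 := by
    by_contra hcon
    push Not at hcon
    exact hbot ((Submodule.eq_bot_iff W).2 hcon)
  set a : ι → 𝕜 := w ∘ Sum.inl with ha
  set b : ι → 𝕜 := (w ∘ Sum.inr) ∘ Sum.inl with hb
  set c : ι → 𝕜 := (w ∘ Sum.inr) ∘ Sum.inr with hc
  have hw : w = Sum.elim a (Sum.elim b c) := by
    ext (i | i | i) <;> rfl
  rw [hw] at hwW
  -- `L₁ ⊆ W`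
  have hL1all : ∀ x : ι → 𝕜, Sum.elim (0 : ι → 𝕜) (Sum.elim x (0 : ι → 𝕜)) ∈ W := by
    by_cases hc0 : c = 0
    · by_cases ha0 : a = 0
      · have hb0 : b ≠ 0 := by
          intro hb0
          apply hw0
          rw [hw, ha0, hb0, hc0]
          ext (i | i | i) <;> rfl
        have h1 := hF a b c hwW
        rw [ha0, neg_zero] at h1
        exact hL1 b 0 hb0 h1
      · rw [hc0] at hwW
        exact hL1 a b ha0 hwW
    · have h1 := hE 1 a b c hwW
      rw [Matrix.one_mulVec, Matrix.one_mulVec] at h1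
      exact hL1 c a hc0 h1
  -- `L₂ ⊆ W` and `L₃ ⊆ W`
  have hL2all : ∀ x : ι → 𝕜, Sum.elim x (Sum.elim (0 : ι → 𝕜) (0 : ι → 𝕜)) ∈ W := by
    intro x
    have h1 := hF 0 x 0 (hL1all x)
    rw [neg_zero] at h1
    exact h1
  have hL3all : ∀ x : ι → 𝕜, Sum.elim (0 : ι → 𝕜) (Sum.elim (0 : ι → 𝕜) x) ∈ W := by
    intro x
    have h1 := hF (-x) 0 0 (hL2all (-x))
    rw [neg_neg] at h1
    exact h1
  -- everything
  rw [eq_top_iff]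
  intro v _
  have hv : v = Sum.elim (v ∘ Sum.inl) (Sum.elim (0 : ι → 𝕜) (0 : ι → 𝕜)) +
      (Sum.elim (0 : ι → 𝕜) (Sum.elim ((v ∘ Sum.inr) ∘ Sum.inl) (0 : ι → 𝕜)) +
        Sum.elim (0 : ι → 𝕜) (Sum.elim (0 : ι → 𝕜) ((v ∘ Sum.inr) ∘ Sum.inr))) := by
    ext (i | i | i) <;> simp
  rw [hv]
  exact W.add_mem (hL2all _) (W.add_mem (hL1all _) (hL3all _))

end Irreducible

/-! ## §4 Closed form of ALL powers: the arbitrary matrix `T` enters only through the two outer factors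
(appended, same hand).  Reading: along a direction that moves only `T` (resp. `T` and `N` with `s` frozen) every power of the
graft has line-degree `≤ 2` (resp. `≤ 2 + ` the line-degree of the powers of `N`) — the `T`-directions are UNIVERSALLY SLOW and
`price_n(graft 𝒩) ≤ price_n(𝒩) + 2n + 1` (window ledger of `𝒩` on `L₂`, two outer factors, one frozen coordinate `s`). -/

section Powers

variable {R : Type*} [CommRing R]
variable {l m : Type*} [Fintype l] [Fintype m] [DecidableEq l] [DecidableEq m]

/-- `(PQ)^(j+1) = P · (QP)^j · Q`. [folklore] -/
theorem pow_succ_sandwich (Q : Matrix l m R) (P : Matrix m l R) (j : ℕ) :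
    (P * Q) ^ (j + 1) = P * (Q * P) ^ j * Q := by
  rw [pow_succ, ← Matrix.mul_assoc, pow_mul_shift Q P j]

/-- Even powers `≥ 2` of a bipartite matrix in SANDWICH form: `[[0,Q],[P,0]]^(2j+2) = [[(QP)^(j+1), 0],[0, P (QP)^j Q]]` —
both blocks are the quadratic block `QP` to a power, dressed by at most one `P` on the left and one `Q` on the right. [folklore] -/
theorem bipartite_pow_even_succ (Q : Matrix l m R) (P : Matrix m l R) (j : ℕ) :
    (fromBlocks 0 Q P 0) ^ (2 * j + 2) = fromBlocks ((Q * P) ^ (j + 1)) 0 0 (P * (Q * P) ^ j * Q) := by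
  rw [show 2 * j + 2 = 2 * (j + 1) by ring, bipartite_pow_even, pow_succ_sandwich Q P j]

/-- Odd powers of a bipartite matrix in SANDWICH form: `[[0,Q],[P,0]]^(2j+1) = [[0, (QP)^j Q],[P (QP)^j, 0]]`. [folklore] -/
theorem bipartite_pow_odd_sandwich (Q : Matrix l m R) (P : Matrix m l R) (j : ℕ) :
    (fromBlocks 0 Q P 0) ^ (2 * j + 1) = fromBlocks 0 ((Q * P) ^ j * Q) (P * (Q * P) ^ j) 0 := by
  rw [bipartite_pow_odd, pow_mul_shift Q P j]

end Powers

section GraftPowers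

variable {R : Type*} [CommRing R] {ι : Type*} [Fintype ι] [DecidableEq ι]

/-- **Even powers of the graft, closed form**: `graft(T,N,s)^(2j+2) = [[(−s)^(j+1) N^(j+1), 0],[0, P·((−s)^j N^j)·Q]]` with
`P = [T ; −s·1]`, `Q = [s·1 | T+N]` — `T` appears at most ONCE on each side of a power of `N`. [folklore] -/
theorem graft_pow_even_succ (T N : Matrix ι ι R) (s : R) (j : ℕ) :
    (fromBlocks 0 (fromCols (s • (1 : Matrix ι ι R)) (T + N)) (fromRows T (-(s • (1 : Matrix ι ι R)))) 0) ^ (2 * j + 2)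
      = fromBlocks ((-s) ^ (j + 1) • N ^ (j + 1)) 0 0
          (fromRows T (-(s • (1 : Matrix ι ι R))) * ((-s) ^ j • N ^ j) * fromCols (s • (1 : Matrix ι ι R)) (T + N)) := by
  rw [bipartite_pow_even_succ, graft_QP, ← neg_smul, smul_pow, smul_pow]

/-- **Odd powers of the graft, closed form**: `graft(T,N,s)^(2j+1) = [[0, ((−s)^j N^j)·Q],[P·((−s)^j N^j), 0]]`. [folklore] -/
theorem graft_pow_odd (T N : Matrix ι ι R) (s : R) (j : ℕ) :
    (fromBlocks 0 (fromCols (s • (1 : Matrix ι ι R)) (T + N)) (fromRows T (-(s • (1 : Matrix ι ι R)))) 0) ^ (2 * j + 1)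
      = fromBlocks 0 (((-s) ^ j • N ^ j) * fromCols (s • (1 : Matrix ι ι R)) (T + N))
          (fromRows T (-(s • (1 : Matrix ι ι R))) * ((-s) ^ j • N ^ j)) 0 := by
  rw [bipartite_pow_odd_sandwich, graft_QP, ← neg_smul, smul_pow]

end GraftPowers

end Summit.ValiantsHypothesis.ValiantsHypothesis.Theorems.GrenetZeon.BipartiteGraft
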